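/-
Copyright (c) 2026. All rights reserved.
Released under Apache 2.0 license as described in the file LICENSE.
Authors: HodgeCM publication cell (pub-hodgecm), GR lane, seat GR-1 (`pub-hodgecm-own-real34`).
-/
import Literature.NumberTheory.GelbartRogawski1991.DoubledWeilRepresentationArchTwistGen
import Literature.NumberTheory.GelbartRogawski1991.QuadExtSplittingCharArchTwistSub
import Literature.NumberTheory.GelbartRogawski1991.QuadExtSplittingCharArchTwistReal
import HarnessLib

/-!
# The archimedean twist of the Siegel-parabolic character of the doubled unitary group — general `E/F`, `E` WITH real places

Topic `NumberTheory/GelbartRogawski1991`; namespace `Literature.NumberTheory.GelbartRogawski1991.GRConstructionGen`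
(telescope of `DoubledUnitaryGlobalSplittingDataGen`).  One definition with body (`archTwistR`, the type-(ii) factor) and
theorems; no `def … : Prop`, no named fact, no `sorry`.  The general-`E` twin of `DoubledWeilRepresentationArchTwistGen`
(`exists_archDetTwist_chiDet_gen`, `E` totally complex).

The infinite places of `F` are of three kinds: real of type (i) (a `c`-fixed COMPLEX place `w₁(k)` of `E` above, `k ∈ κ₁`),
real of type (ii) (two REAL places `w₂(k)`, `c w₂(k)` above, `k ∈ κ₂`), complex (two complex places `w_ℂ(v)`, `c w_ℂ(v)` above).
The twisting character is the product of three continuous characters of `H(F ⊗ ℝ) = U(J^𝔻)(F ⊗ ℝ)`: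

* `η₁ = ∏_{κ₁} det(g_{w₁ k})^{(e_k+1)/2}` (odd `e_k`; `QuadExtSplittingCharArchTwistSub.exists_archDetTwist_doubled_sub'`),
* **`archTwistR χ w₂ = ∏_{κ₂} χ̃_{w₂ k} ∘ det ∘ (·)_{w₂ k}`** (`χ̃_w = archComponentR χ w`, `QuadExtSplittingCharArchTwistReal`),
* `archTwistC χ w_ℂ = ∏_{v complex} χ̃_{w_ℂ v} ∘ σ ∘ det ∘ (·)_{w_ℂ v}` (`DoubledWeilRepresentationArchTwistGen`),

and **`exists_archDetTwist_chiDet_real`**: for `χ` unitary with `χ|_{𝕀_F} = ε_{E/F}` and `g ∈ P_Δ(F ⊗ ℝ)`,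
`η(g)² · ∏_{κ₁} det(g_{w₁ k})⁻¹ = χ(det_Δ (g,1))²`, `η = η₁ · archTwistR · archTwistC` — the type-(ii) and complex factors of
`χ(det_Δ (g,1)) = ∏_{w ∣ ∞} χ_w(u_w)` ARE the values of `archTwistR`, `archTwistC` (exactly; `archComponentR_det_evalR_eq`,
`prod_archComponent_placesOver_eq_archComponentC_detAtC`), the type-(i) factors square to `η₁² ∏ det⁻¹`.  This is the
squares condition `hηS` of `DoubledWeilRepresentationArchLiftReps` for a Folland-framed section `sW` with
`quot(sW g) = ∏_{κ₁} det(g_{w₁ k})⁻¹ · ∏_{κ₂} sgn det g_{w₂ k}` once multiplied by `sgnA g = ∏_{κ₂} sgn det g_{w₂ k}`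
(`DoubledUnitaryArchSiegelRealSign`); the formula of `η₁` is exported so that `η` can be evaluated at the Levi sign
representatives.  The indexing of the places is abstract (binders `w₁ hw₁ w₂ wC hoverC eF hover₁ hover₂`; of record:
`IsTypeOne`, `placeAboveOne`, `placeAboveTwo`, `placeAboveComplex` of `Automorphic/QuadExtPlacesAbove`).

([GelbartRogawski1991, §3.1 Prop. 3.1.1 p. 455, (3.1.2) p. 456]; [Kudla1994, §3]; [Paul1998, §1.2 (1.2.1)–(1.2.2)];
[HarrisKudlaSweet1996, §1 (1.15)].)  Written for the stage-1 cell `pub-hodgecm` (seat GR-1); nothing here is a claim of the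
manuscripts adjudicated by that cell.

## References

* S. Gelbart, J. Rogawski, Invent. Math. 105 (1991), §3.1 Prop. 3.1.1 p. 455, (3.1.2) p. 456 [GelbartRogawski1991].
* S. S. Kudla, Israel J. Math. 87 (1994), §3 [Kudla1994].
* A. Paul, J. Funct. Anal. 159 (1998), §1.2 (1.2.1)–(1.2.2) p. 389 [Paul1998].
* M. Harris, S. S. Kudla, W. J. Sweet, J. Amer. Math. Soc. 9 (1996), §1 (1.15) [HarrisKudlaSweet1996].
-/

set_option autoImplicit false

noncomputable section

open scoped Classical ComplexConjugate MatrixGroups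
open scoped Matrix
open NumberField NumberField.InfinitePlace NumberField.mixedEmbedding IsDedekindDomain
open Literature.NumberTheory.Automorphic Literature.NumberTheory.Automorphic.UnitaryGroup
open Literature.NumberTheory.Weil1964
open Literature.NumberTheory.GaloisRepresentations
open Literature.RepresentationTheory.HeisenbergGroup
open Literature.RepresentationTheory.HarrisKudlaSweet1996
open Literature.NumberTheory.QuadraticForms (ideleInfiniteComponent val_ideleInfiniteComponent)
open Literature.NumberTheory.GelbartRogawski1991.UnitaryDualPair.ArchSplitting
open Literature.NumberTheory.GelbartRogawski1991.UnitaryDualPair.ArchSplitting.QuadExt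

namespace Literature.NumberTheory.GelbartRogawski1991.GRConstructionGen

open UnitaryDualPair

variable (F : Type) [Field F] [NumberField F] (E : Type) [Field E] [NumberField E] [Algebra F E]
  [Algebra.IsQuadraticExtension F E]
variable (c : E ≃ₐ[F] E) {δ : E} (hcδ : c δ = -δ) (hδ : δ ≠ 0)
variable {N M n : ℕ} (e : Fin N × Fin M ≃ Fin n)
  (TV : Matrix (Fin N) (Fin N) F) (hVd : IsUnit TV.det) (TW : Matrix (Fin M) (Fin M) F) (hWd : IsUnit TW.det)

/-! ## §1 The type-(ii) factor `archTwistR χ w₂ = ∏_k χ̃_{w₂ k} ∘ det ∘ (·)_{w₂ k}` -/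

section TwistR

variable {κ₂ : Type*} [Fintype κ₂] (w₂ : κ₂ → {w : InfinitePlace E // w.IsReal})

/-- the real unit `det g_w` as a homomorphism `U(J^𝔻)(F ⊗ ℝ) →* ℝˣ`. [cite: Kudla1994, §3] -/
abbrev detUnitR (w : {w : InfinitePlace E // w.IsReal}) : UnitaryGroup.arch F E c (n + n) (hermD F E e TV TW) →* ℝˣ :=
  (Units.map (evalR E w : mixedSpace E →+* ℝ).toMonoidHom).comp
    ((Matrix.GeneralLinearGroup.det : GL (Fin (n + n)) (mixedSpace E) →* (mixedSpace E)ˣ).comp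
      (UnitaryGroup.arch F E c (n + n) (hermD F E e TV TW)).subtype)

/-- **`η_ℝ = ∏_{k} χ̃_{w₂ k} ∘ det ∘ (·)_{w₂ k}`** — the product over the chosen REAL places `w₂ k` of `E` (one over each real
place of `F` split in `E`) of the characters `g ↦ χ̃_{w₂ k}(det g_{w₂ k})`. [cite: GelbartRogawski1991, §3.1 p. 456 (3.1.2)] -/
def archTwistR (χ : HeckeCharacter E) : UnitaryGroup.arch F E c (n + n) (hermD F E e TV TW) →* ℂˣ :=
  ∏ k : κ₂, (archComponentR E χ (w₂ k)).comp (detUnitR F E c e TV TW (w₂ k))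

omit [NumberField F] [Algebra.IsQuadraticExtension F E] in
/-- formula. [cite: GelbartRogawski1991, §3.1 p. 456 (3.1.2)] -/
theorem archTwistR_apply (χ : HeckeCharacter E) (g : UnitaryGroup.arch F E c (n + n) (hermD F E e TV TW)) :
    archTwistR F E c e TV TW w₂ χ g =
      ∏ k : κ₂, archComponentR E χ (w₂ k)
        (Units.map (evalR E (w₂ k) : mixedSpace E →+* ℝ).toMonoidHom
          (Matrix.GeneralLinearGroup.det (g : GL (Fin (n + n)) (mixedSpace E)))) := by
  simp only [archTwistR, MonoidHom.finsetProd_apply, MonoidHom.comp_apply, Subgroup.coe_subtype]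

omit [NumberField F] [Algebra.IsQuadraticExtension F E] in
/-- `η_ℝ` is continuous. [cite: GelbartRogawski1991, §3.1 p. 456 (3.1.2)] -/
theorem continuous_archTwistR (χ : HeckeCharacter E) :
    Continuous fun g => ((archTwistR F E c e TV TW w₂ χ g : ℂˣ) : ℂ) := by
  simp only [archTwistR_apply, Units.coe_prod]
  refine continuous_finsetProd _ fun k _ => ?_
  have hev : Continuous (evalR E (w₂ k) : mixedSpace E → ℝ) := (continuous_apply (w₂ k)).comp continuous_fst
  have hval : Continuous fun g : UnitaryGroup.arch F E c (n + n) (hermD F E e TV TW) =>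
      ((Units.map (evalR E (w₂ k) : mixedSpace E →+* ℝ).toMonoidHom
        (Matrix.GeneralLinearGroup.det (g : GL (Fin (n + n)) (mixedSpace E))) : ℝˣ) : ℝ) := by
    have h : (fun g : UnitaryGroup.arch F E c (n + n) (hermD F E e TV TW) =>
        ((Units.map (evalR E (w₂ k) : mixedSpace E →+* ℝ).toMonoidHom
          (Matrix.GeneralLinearGroup.det (g : GL (Fin (n + n)) (mixedSpace E))) : ℝˣ) : ℝ)) =
        fun g : UnitaryGroup.arch F E c (n + n) (hermD F E e TV TW) =>
          ((((g : GL (Fin (n + n)) (mixedSpace E)) : Matrix (Fin (n + n)) (Fin (n + n)) (mixedSpace E))).map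
            (evalR E (w₂ k))).det := by
      funext g
      simp only [Units.coe_map, RingHom.toMonoidHom_eq_coe, MonoidHom.coe_coe, Matrix.GeneralLinearGroup.val_det_apply,
        RingHom.map_det, RingHom.mapMatrix_apply]
    rw [h]
    exact ((Units.continuous_val.comp continuous_subtype_val).matrix_map hev).matrix_det
  have hdet : Continuous fun g : UnitaryGroup.arch F E c (n + n) (hermD F E e TV TW) =>
      (Units.map (evalR E (w₂ k) : mixedSpace E →+* ℝ).toMonoidHom
        (Matrix.GeneralLinearGroup.det (g : GL (Fin (n + n)) (mixedSpace E)))) :=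
    Units.isEmbedding_val₀.continuous_iff.2 hval
  exact Units.continuous_val.comp ((continuous_archComponentR E χ (w₂ k)).comp hdet)

end TwistR

/-! ## §2 The archimedean twist for `E` with real places -/

include hcδ hδ hVd hWd in
/-- **The archimedean twist of the Siegel-parabolic character of `H = U(J^𝔻)`, `E` WITH real places allowed.**  Index the
real places of `F` of type (i) by `κ₁` (with a `c`-fixed complex place `w₁ k` of `E` above) and of type (ii) by `κ₂` (with a
real place `w₂ k` above; the other is `c w₂ k`), `eF : κ₁ ⊕ κ₂ ≃ {v real}`, and the complex places `v` by a place `w_ℂ v`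
above.  For `χ` unitary with `χ|_{𝕀_F} = ε_{E/F}` there are odd `e_k` and the continuous characters
`η₁ = ∏_{κ₁} det(g_{w₁ k})^{(e_k+1)/2}`, `η = η₁ · archTwistR χ w₂ · archTwistC χ w_ℂ` with, for every `g ∈ U(J^𝔻)(F ⊗ ℝ)` with
`(g,1) ∈ P_Δ(𝔸)`: `η(g)² · ∏_{κ₁} det(g_{w₁ k})⁻¹ = χ(det_Δ (g,1))²`.
[cite: GelbartRogawski1991, §3.1 Prop. 3.1.1 p. 455] [cite: Kudla1994, §3] [cite: Paul1998, §1.2 (1.2.1)–(1.2.2) p. 389 L11–29] -/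
theorem exists_archDetTwist_chiDet_real {χ : HeckeCharacter E} (hχu : χ.IsUnitary) (hχ : IsSplittingCharExt F E 1 χ)
    {κ₁ κ₂ : Type*} [Fintype κ₁] [Fintype κ₂]
    (w₁ : κ₁ → {w : InfinitePlace E // w.IsComplex}) (hw₁ : ∀ k, c • (w₁ k).1 = (w₁ k).1)
    (w₂ : κ₂ → {w : InfinitePlace E // w.IsReal})
    (wC : {v : InfinitePlace F // v.IsComplex} → {w : InfinitePlace E // w.IsComplex})
    (hoverC : ∀ v, (wC v).1.comap (algebraMap F E) = v.1)
    (eF : κ₁ ⊕ κ₂ ≃ {v : InfinitePlace F // v.IsReal})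
    (hover₁ : ∀ k, (w₁ k).1.comap (algebraMap F E) = (eF (Sum.inl k)).1)
    (hover₂ : ∀ k, (w₂ k).1.comap (algebraMap F E) = (eF (Sum.inr k)).1) :
    ∃ (ex : κ₁ → ℤ) (η₁ : UnitaryGroup.arch F E c (n + n) (hermD F E e TV TW) →* ℂˣ),
      (∀ k, Odd (ex k)) ∧
      (∀ g, ((η₁ g : ℂˣ) : ℂ) =
        ∏ k : κ₁,
          ((((UnitaryGroup.archAt F E c (n + n) (hermD F E e TV TW) (w₁ k) (hw₁ k)
              (LocalSplitting.galConj_ne_one_of_delta F E c hcδ hδ) g :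
              UnitaryGroup.archLocal E (n + n) (hermD F E e TV TW) (w₁ k)) : GL (Fin (n + n)) ℂ) :
              Matrix (Fin (n + n)) (Fin (n + n)) ℂ).det) ^ ((ex k + 1) / 2)) ∧
      (Continuous fun g => (((η₁ * archTwistR F E c e TV TW w₂ χ * archTwistC F E c e TV TW χ wC) g : ℂˣ) : ℂ)) ∧
      ∀ g : UnitaryGroup.arch F E c (n + n) (hermD F E e TV TW),
        IsSiegelDelta F E c e TV TW (UnitaryGroup.archToAdelic F E c (n + n) (hermD F E e TV TW) g) →
          (((η₁ * archTwistR F E c e TV TW w₂ χ * archTwistC F E c e TV TW χ wC) g : ℂˣ) : ℂ) ^ 2 *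
              ∏ k : κ₁,
                ((((UnitaryGroup.archAt F E c (n + n) (hermD F E e TV TW) (w₁ k) (hw₁ k)
                    (LocalSplitting.galConj_ne_one_of_delta F E c hcδ hδ) g :
                    UnitaryGroup.archLocal E (n + n) (hermD F E e TV TW) (w₁ k)) : GL (Fin (n + n)) ℂ) :
                    Matrix (Fin (n + n)) (Fin (n + n)) ℂ).det)⁻¹ =
            ((chiDet F E c e TV TW χ (UnitaryGroup.archToAdelic F E c (n + n) (hermD F E e TV TW) g) : ℂˣ) : ℂ) ^ 2 := by
  have hc1 : c ≠ 1 := LocalSplitting.galConj_ne_one_of_delta F E c hcδ hδ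
  have hcc : c * c = 1 := AlgEquiv.ext (LocalSplitting.galConj_apply_apply F E c hcδ hδ)
  have hcinv : c⁻¹ = c := inv_eq_of_mul_eq_one_right hcc
  obtain ⟨ex, η₁, hodd, hη₁f, hη₁c, hη₁⟩ := hχ.exists_archDetTwist_doubled_sub' F E c hc1 hcδ hδ w₁ hw₁
    (gramR F e TV TW) (isUnit_det_gramR₀ F e TV hVd TW hWd) (hermD F E e TV TW)
    (hermD_eq_map_reindex_fromBlocks_gen F E e TV TW) hχu
  refine ⟨ex, η₁, hodd, hη₁f, ?_, fun g hS => ?_⟩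
  · have h : (fun g => (((η₁ * archTwistR F E c e TV TW w₂ χ * archTwistC F E c e TV TW χ wC) g : ℂˣ) : ℂ)) =
        fun g => ((η₁ g : ℂˣ) : ℂ) * ((archTwistR F E c e TV TW w₂ χ g : ℂˣ) : ℂ) * ((archTwistC F E c e TV TW χ wC g : ℂˣ) : ℂ) :=
      funext fun g => by rw [MonoidHom.mul_apply, MonoidHom.mul_apply, Units.val_mul, Units.val_mul]
    rw [h]
    exact (hη₁c.mul (continuous_archTwistR F E c e TV TW w₂ χ)).mul (continuous_archTwistC F E c e TV TW χ wC)
  have hu := isUnit_detDelta_of_isSiegelDelta F E c e TV TW _ hS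
  have hu2 : (((hu.unit : ideleGroup E) : AdeleRing (𝓞 E) E)).2 = 1 := by
    rw [hu.unit_spec]
    exact snd_det_deltaBlock_archToAdelic F E c (hermD F E e TV TW) g
  -- the fibres of `w ↦ w|_F`
  have hfib₁ : ∀ k : κ₁,
      ∏ w' : InfPlacesOver E (eF (Sum.inl k)).1, χ.archComponent w'.1 (ideleInfiniteComponent E w'.1 hu.unit) =
        χ.archComponent (w₁ k).1 (ideleInfiniteComponent E (w₁ k).1 hu.unit) := by
    intro k
    have huniv : (Finset.univ : Finset (InfPlacesOver E (eF (Sum.inl k)).1)) = {⟨(w₁ k).1, hover₁ k⟩} := by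
      ext w'
      simp only [Finset.mem_univ, Finset.mem_singleton, true_iff]
      exact Subtype.ext (QuadExt.eq_of_comap_eq_of_smul_eq F E c (w₁ k) (hw₁ k) hc1 w'.1 (w'.2.trans (hover₁ k).symm))
    rw [huniv, Finset.prod_singleton]
  have hfib₂ : ∀ k : κ₂,
      ∏ w' : InfPlacesOver E (eF (Sum.inr k)).1, χ.archComponent w'.1 (ideleInfiniteComponent E w'.1 hu.unit) =
        χ.archComponent (w₂ k).1 (ideleInfiniteComponent E (w₂ k).1 hu.unit) *
          χ.archComponent (c⁻¹ • (w₂ k).1) (ideleInfiniteComponent E (c⁻¹ • (w₂ k).1) hu.unit) := by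
    intro k
    have hne : (⟨(w₂ k).1, hover₂ k⟩ : InfPlacesOver E (eF (Sum.inr k)).1) ≠
        ⟨c • (w₂ k).1, (comap_smul_eq' F E c (w₂ k).1).trans (hover₂ k)⟩ :=
      fun h => smul_ne_of_isReal F E c (w₂ k) hc1 (congrArg Subtype.val h).symm
    have huniv : (Finset.univ : Finset (InfPlacesOver E (eF (Sum.inr k)).1)) =
        {⟨(w₂ k).1, hover₂ k⟩, ⟨c • (w₂ k).1, (comap_smul_eq' F E c (w₂ k).1).trans (hover₂ k)⟩} := by
      ext w'
      simp only [Finset.mem_univ, Finset.mem_insert, Finset.mem_singleton, true_iff]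
      rcases eq_or_eq_smul_of_isReal F E c (w₂ k) hc1 w'.1 (w'.2.trans (hover₂ k).symm) with h | h
      · exact Or.inl (Subtype.ext h)
      · exact Or.inr (Subtype.ext h)
    rw [huniv, Finset.prod_pair hne, hcinv]
  have hcx : ∀ v : {v : InfinitePlace F // v.IsComplex},
      ∏ w' : InfPlacesOver E v.1, χ.archComponent w'.1 (ideleInfiniteComponent E w'.1 hu.unit) =
        archComponentC E χ (wC v) (detAtC F E c (hermD F E e TV TW) (wC v) g) :=
    fun v => prod_archComponent_placesOver_eq_archComponentC_detAtC F E c v (wC v)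
      (hoverC v) (gramR F e TV TW) (isUnit_det_gramR₀ F e TV hVd TW hWd) (hermD F E e TV TW)
      (hermD_eq_map_reindex_fromBlocks_gen F E e TV TW) hc1 hcc hχ g hu.unit hS hu.unit_spec
  -- the type-(ii) factor IS the value of `archTwistR`
  have hR : ∀ k : κ₂,
      χ.archComponent (w₂ k).1 (ideleInfiniteComponent E (w₂ k).1 hu.unit) *
          χ.archComponent (c⁻¹ • (w₂ k).1) (ideleInfiniteComponent E (c⁻¹ • (w₂ k).1) hu.unit) =
        archComponentR E χ (w₂ k)
          (Units.map (evalR E (w₂ k) : mixedSpace E →+* ℝ).toMonoidHom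
            (Matrix.GeneralLinearGroup.det (g : GL (Fin (n + n)) (mixedSpace E)))) :=
    fun k => (archComponentR_det_evalR_eq F E c hcδ hδ e TV hVd TW hWd hc1 hcc hχ g hS hu.unit hu.unit_spec (w₂ k)).symm
  -- `χ(det_Δ) = (∏_{κ₁} χ_{w₁ k}(u_{w₁ k})) · η_ℝ(g) · η_ℂ(g)`
  have hχdet : ((chiDet F E c e TV TW χ (UnitaryGroup.archToAdelic F E c (n + n) (hermD F E e TV TW) g) : ℂˣ) : ℂ) =
      (∏ k : κ₁, ((χ.archComponent (w₁ k).1 (ideleInfiniteComponent E (w₁ k).1 hu.unit) : ℂˣ) : ℂ)) *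
        ((archTwistR F E c e TV TW w₂ χ g : ℂˣ) : ℂ) * ((archTwistC F E c e TV TW χ wC g : ℂˣ) : ℂ) := by
    simp only [chiDet, dif_pos hu]
    rw [apply_eq_prod_archComponent_of_snd_eq_one E χ hu.unit hu2, prod_infinitePlace_eq_prod_placesOver F E,
      InfinitePlace.prod_eq_prod_mul_prod, ← Fintype.prod_equiv eF (fun s => ∏ w' : InfPlacesOver E (eF s).1,
        χ.archComponent w'.1 (ideleInfiniteComponent E w'.1 hu.unit)) _ (fun _ => rfl), Fintype.prod_sum_type,
      Units.val_mul, Units.val_mul, Units.coe_prod, Units.coe_prod, Units.coe_prod, archTwistR_apply, archTwistC_apply,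
      Units.coe_prod, Units.coe_prod]
    congr 1
    congr 1
    · exact Finset.prod_congr rfl fun k _ => by rw [hfib₁ k]
    · exact Finset.prod_congr rfl fun k _ => by rw [hfib₂ k, hR k]
    · exact Finset.prod_congr rfl fun v _ => by rw [hcx v]
  -- the type-(i) identity and the final algebra
  have h1 := hη₁ g hu.unit hS hu.unit_spec
  rw [Finset.prod_pow] at h1
  rw [MonoidHom.mul_apply, MonoidHom.mul_apply, Units.val_mul, Units.val_mul, hχdet]
  linear_combination (((archTwistR F E c e TV TW w₂ χ g : ℂˣ) : ℂ) * ((archTwistC F E c e TV TW χ wC g : ℂˣ) : ℂ)) ^ 2 * h1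

end Literature.NumberTheory.GelbartRogawski1991.GRConstructionGen

end
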